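import Literature.NumberTheory.QuadraticFields.ThreeTorsionMeanCount
import Literature.NumberTheory.Sieve.SquarefreeProgressions
import HarnessLib

/-!
# Taniguchi–Thorne, Lemma 21: counting quadratic fields in a progression (proof)

This file DISCHARGES the named fact `tt_count_quadraticFields_progression` of
`ThreeTorsionMean.lean` — T. Taniguchi, F. Thorne, *Secondary terms in counting functions for
cubic fields*, Duke Math. J. 162 (2013), Lemma 21 [cite: TaniguchiThorne2013, Lemma 21]: for
`2⁶ ∣ m` and each sign, the number of fundamental discriminants `0 < ±D < X`, `D ≡ a (mod m)` is
`(8/(π² m)) e(a, 2) ∏_{p > 2, pᵏ ∥ m} e(a, pᵏ)(1 − p⁻²)⁻¹ X + O(√X)` — as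
`tt_count_quadraticFields_progression_holds`. The source omits the proof ("a relatively
straightforward generalization of [Tenenbaum, I.3.7, Thm 9]"); the proof given here is that
generalization:

1. `Sieve/SquarefreeProgressions`: square-free `0 < n ≤ N`, `n ≡ r (q)` number `g(q, r) N + O(√N)`
   (Legendre's `∑_{d² ∣ n} μ(d)`, one class modulo `lcm(d², q)` per `d ≤ √N`, tail `∑_{d>√N} d⁻²`);
2. `Sieve/SquarefreeProgressionsDensity` + `ThreeTorsionMeanCount`: `g(q, r)` is the printed Euler
   product (file `ThreeTorsionMeanCount.lean`; its docstring's "assembled in `ThreeTorsionMeanProofs`"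
   means THIS file — the name `ThreeTorsionMeanProofs.lean` was meanwhile taken by the proof of the
   unrestricted count `#{0 < ±D < X} = (3/π²) X + O(√X)`), with `e(r, pᵏ)` at odd `p` and `4/3` at `2` when `4 ∣ q`, `4 ∤ r`;
3. `ThreeTorsionMeanCount`: modulo `m` (`64 ∣ m`) the class `a` decides the kind of `D`:
   `a ≡ 1 (4)` ⇒ `D` square-free (minus the point `D = 1`), `a ≡ 8, 12 (16)` ⇒ `D = 4d` with
   `d ≡ a/4 (mod m/4)` square-free, otherwise nothing; the two main terms are `dens · X` each, and
   `[a ≡ 1 (4)] + [a ≡ 8, 12 (16)] = e(a, 2)`;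
4. here: the error bookkeeping (`|N − X| ≤ 1`, `|4⌊N/4⌋ − X| ≤ 4`, constants `7 + 5·dens`), the
   reflection `D ↦ −D` for negative discriminants, and the degenerate modulus `m = 0`.

No definitions are introduced; the implied constant obtained is `7 + 5 c'(m, a)` with
`c'(m, a) = (8/(π² m)) ∏_{p > 2} e(a, pᵏ)(1 − p⁻²)⁻¹`.
-/

noncomputable section

open Finset ArithmeticFunction
open scoped ArithmeticFunction.Moebius

namespace Literature.NumberTheory.QuadraticFields

/-- **First kind, with error**: for `4 ∣ m ≠ 0`, `σ = ±1`,
`|#{0 < n ≤ N : σn ≡ 1 (4) sq-free ≠ 1, σn ≡ a (m)} − [a ≡ 1 (4)] c' (N + 1)| ≤ (4 + |c'|) √(N+1)`.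
[cite: TaniguchiThorne2013, Lemma 21] -/
theorem abs_card_typeOne_sub_le {m : ℕ} (hm0 : m ≠ 0) (hm4 : 4 ∣ m) (a : ℤ) {σ : ℤ}
    (hσ : σ = 1 ∨ σ = -1) (N : ℕ) :
    |(#{n ∈ Ioc (0 : ℤ) N | (σ * n % 4 = 1 ∧ Squarefree (σ * n) ∧ σ * n ≠ 1) ∧
        σ * n ≡ a [ZMOD m]} : ℝ)
      - (if a % 4 = 1 then 8 / (Real.pi ^ 2 * m) * ∏ p ∈ m.primeFactors.erase 2,
          ttLocalFactorOdd p (m.factorization p) a * (1 - 1 / (p : ℝ) ^ 2)⁻¹ else 0) *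
        ((N : ℝ) + 1)|
      ≤ (4 + |8 / (Real.pi ^ 2 * m) * ∏ p ∈ m.primeFactors.erase 2,
          ttLocalFactorOdd p (m.factorization p) a * (1 - 1 / (p : ℝ) ^ 2)⁻¹|) *
        Real.sqrt ((N : ℝ) + 1) := by
  have hsq1 : 1 ≤ Real.sqrt ((N : ℝ) + 1) :=
    Real.one_le_sqrt.mpr (by linarith [(Nat.cast_nonneg N : (0 : ℝ) ≤ N)])
  have hsqN : Real.sqrt N ≤ Real.sqrt ((N : ℝ) + 1) := Real.sqrt_le_sqrt (by linarith)
  rw [card_typeOne hσ hm4 a N]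
  split_ifs with ha
  · have hna : ¬ (4 : ℤ) ∣ a := by omega
    have hK := Sieve.abs_card_squarefree_progression_sign_sub_le (Nat.pos_of_ne_zero hm0) a hσ N
    rw [tsum_density_eq_ttLocalFactors hm0 hm4 hna] at hK
    have h1 := abs_card_typeOne_sub_card_le hσ m a N
    set dens := 8 / (Real.pi ^ 2 * m) * ∏ p ∈ m.primeFactors.erase 2,
      ttLocalFactorOdd p (m.factorization p) a * (1 - 1 / (p : ℝ) ^ 2)⁻¹ with hdens
    set c := (#{n ∈ Ioc (0 : ℤ) N | (σ * n ≡ a [ZMOD m] ∧ Squarefree n) ∧ σ * n ≠ 1} : ℝ)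
      with hc
    set K := (#{n ∈ Ioc (0 : ℤ) N | σ * n ≡ a [ZMOD m] ∧ Squarefree n} : ℝ) with hK'
    have hdn : 0 ≤ |dens| := abs_nonneg _
    have hmul : |dens| * 1 ≤ |dens| * Real.sqrt ((N : ℝ) + 1) :=
      mul_le_mul_of_nonneg_left hsq1 hdn
    calc |c - dens * ((N : ℝ) + 1)| = |(c - K) + (K - dens * N) + (-dens)| := by
          congr 1; ring
      _ ≤ |c - K| + |K - dens * N| + |-dens| := abs_add_three _ _ _
      _ ≤ 1 + 3 * Real.sqrt N + |dens| := by rw [abs_neg]; linarith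
      _ ≤ (4 + |dens|) * Real.sqrt ((N : ℝ) + 1) := by linarith
  · simp only [Nat.cast_zero, zero_mul, sub_zero, abs_zero]
    positivity

/-- **Second kind, with error**: for `64 ∣ m ≠ 0`, `σ = ±1`,
`|#{0 < n ≤ N : σn = 4d, d ≡ 2,3 (4) sq-free, σn ≡ a (m)} − [a ≡ 8,12 (16)] c' (N + 1)| ≤ (3 + 4|c'|) √(N+1)`.
[cite: TaniguchiThorne2013, Lemma 21] -/
theorem abs_card_typeTwo_sub_le {m : ℕ} (hm0 : m ≠ 0) (hm : 64 ∣ m) (a : ℤ) {σ : ℤ}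
    (hσ : σ = 1 ∨ σ = -1) (N : ℕ) :
    |(#{n ∈ Ioc (0 : ℤ) N | (4 ∣ σ * n ∧ (σ * n / 4 % 4 = 2 ∨ σ * n / 4 % 4 = 3) ∧
        Squarefree (σ * n / 4)) ∧ σ * n ≡ a [ZMOD m]} : ℝ)
      - (if 4 ∣ a ∧ (a / 4 % 4 = 2 ∨ a / 4 % 4 = 3) then
          8 / (Real.pi ^ 2 * m) * ∏ p ∈ m.primeFactors.erase 2,
            ttLocalFactorOdd p (m.factorization p) a * (1 - 1 / (p : ℝ) ^ 2)⁻¹ else 0) *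
        ((N : ℝ) + 1)|
      ≤ (3 + 4 * |8 / (Real.pi ^ 2 * m) * ∏ p ∈ m.primeFactors.erase 2,
          ttLocalFactorOdd p (m.factorization p) a * (1 - 1 / (p : ℝ) ^ 2)⁻¹|) *
        Real.sqrt ((N : ℝ) + 1) := by
  have hm4 : 4 ∣ m := dvd_trans ⟨16, by norm_num⟩ hm
  have hm16 : 4 ∣ m / 4 := by
    obtain ⟨k, rfl⟩ := hm
    exact ⟨4 * k, by omega⟩
  have hq0 : m / 4 ≠ 0 := by
    obtain ⟨k, rfl⟩ := hm
    omega
  have hsq1 : 1 ≤ Real.sqrt ((N : ℝ) + 1) :=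
    Real.one_le_sqrt.mpr (by linarith [(Nat.cast_nonneg N : (0 : ℝ) ≤ N)])
  rw [card_typeTwo hσ hm4 hm16 a N]
  split_ifs with hc
  · have hna : ¬ (4 : ℤ) ∣ a / 4 := by omega
    have hK := Sieve.abs_card_squarefree_progression_sign_sub_le (Nat.pos_of_ne_zero hq0) (a / 4)
      hσ (N / 4)
    rw [tsum_density_eq_ttLocalFactors hq0 hm16 hna, prod_ttLocalFactorOdd_div_four hm0 hm4 hc.1,
      Nat.cast_div hm4 (by norm_num : ((4 : ℕ) : ℝ) ≠ 0)] at hK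
    set P := ∏ p ∈ m.primeFactors.erase 2,
      ttLocalFactorOdd p (m.factorization p) a * (1 - 1 / (p : ℝ) ^ 2)⁻¹ with hP
    set dens := 8 / (Real.pi ^ 2 * m) * P with hdens
    set K := (#{k ∈ Ioc (0 : ℤ) (N / 4 : ℕ) |
      σ * k ≡ a / 4 [ZMOD ((m / 4 : ℕ) : ℤ)] ∧ Squarefree k} : ℝ) with hK'
    have hmR : (m : ℝ) ≠ 0 := by exact_mod_cast hm0
    have hg2 : 8 / (Real.pi ^ 2 * ((m : ℝ) / ((4 : ℕ) : ℝ))) * P = 4 * dens := by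
      rw [hdens]
      push_cast
      field_simp
    rw [hg2] at hK
    have hN4a : (4 : ℝ) * ((N / 4 : ℕ) : ℝ) ≤ N := by exact_mod_cast Nat.mul_div_le N 4
    have hN4b : (N : ℝ) + 1 ≤ 4 * ((N / 4 : ℕ) : ℝ) + 4 := by
      have h := Nat.lt_mul_div_succ N (by norm_num : 0 < 4)
      have h' : N + 1 ≤ 4 * (N / 4) + 4 := by omega
      exact_mod_cast h'
    have hsq4 : Real.sqrt ((N / 4 : ℕ) : ℝ) ≤ Real.sqrt ((N : ℝ) + 1) :=
      Real.sqrt_le_sqrt (by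
        have : ((N / 4 : ℕ) : ℝ) ≤ N := by exact_mod_cast Nat.div_le_self N 4
        linarith)
    have hdn : 0 ≤ |dens| := abs_nonneg _
    have hmul : |dens| * 1 ≤ |dens| * Real.sqrt ((N : ℝ) + 1) :=
      mul_le_mul_of_nonneg_left hsq1 hdn
    have hmid : |dens * (4 * ((N / 4 : ℕ) : ℝ) - ((N : ℝ) + 1))| ≤ |dens| * 4 := by
      rw [abs_mul]
      refine mul_le_mul_of_nonneg_left ?_ hdn
      rw [abs_le]
      constructor <;> linarith
    calc |K - dens * ((N : ℝ) + 1)|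
        = |(K - 4 * dens * ((N / 4 : ℕ) : ℝ)) + dens * (4 * ((N / 4 : ℕ) : ℝ) - ((N : ℝ) + 1))| := by
          congr 1; ring
      _ ≤ |K - 4 * dens * ((N / 4 : ℕ) : ℝ)| + |dens * (4 * ((N / 4 : ℕ) : ℝ) - ((N : ℝ) + 1))| :=
          abs_add_le _ _
      _ ≤ 3 * Real.sqrt ((N / 4 : ℕ) : ℝ) + |dens| * 4 := add_le_add hK hmid
      _ ≤ (3 + 4 * |dens|) * Real.sqrt ((N : ℝ) + 1) := by linarith
  · simp only [Nat.cast_zero, zero_mul, sub_zero, abs_zero]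
    positivity

/-- **Both kinds**: for `64 ∣ m ≠ 0`, `σ = ±1`, `N ≥ 0`, the fundamental discriminants `D = σ n`,
`0 < n ≤ N`, `D ≡ a (mod m)` number `c(m, a) (N + 1) + θ (7 + 5 c'(m, a)) √(N + 1)`, `|θ| ≤ 1`,
with `c(m, a) = ttQuadraticFieldsDensity m a = e(a, 2) c'(m, a)`. [cite: TaniguchiThorne2013, Lemma 21] -/
theorem abs_card_fundDiscr_sign_sub_le {m : ℕ} (hm0 : m ≠ 0) (hm : 64 ∣ m) (a : ℤ) {σ : ℤ}
    (hσ : σ = 1 ∨ σ = -1) (N : ℕ) :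
    |(#{n ∈ Ioc (0 : ℤ) N | ((σ * n % 4 = 1 ∧ Squarefree (σ * n) ∧ σ * n ≠ 1) ∨
        (4 ∣ σ * n ∧ (σ * n / 4 % 4 = 2 ∨ σ * n / 4 % 4 = 3) ∧ Squarefree (σ * n / 4))) ∧
        σ * n ≡ a [ZMOD m]} : ℝ) - ttQuadraticFieldsDensity m a * ((N : ℝ) + 1)|
      ≤ (7 + 5 * |8 / (Real.pi ^ 2 * m) * ∏ p ∈ m.primeFactors.erase 2,
          ttLocalFactorOdd p (m.factorization p) a * (1 - 1 / (p : ℝ) ^ 2)⁻¹|) *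
        Real.sqrt ((N : ℝ) + 1) := by
  have hm4 : 4 ∣ m := dvd_trans ⟨16, by norm_num⟩ hm
  have h1 := abs_card_typeOne_sub_le hm0 hm4 a hσ N
  have h2 := abs_card_typeTwo_sub_le hm0 hm a hσ N
  set dens := 8 / (Real.pi ^ 2 * m) * ∏ p ∈ m.primeFactors.erase 2,
    ttLocalFactorOdd p (m.factorization p) a * (1 - 1 / (p : ℝ) ^ 2)⁻¹ with hdens
  -- split the count by kind (the kinds are disjoint: `σ n ≡ 1 (4)` versus `4 ∣ σ n`)
  have hsplit : (#{n ∈ Ioc (0 : ℤ) N | ((σ * n % 4 = 1 ∧ Squarefree (σ * n) ∧ σ * n ≠ 1) ∨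
      (4 ∣ σ * n ∧ (σ * n / 4 % 4 = 2 ∨ σ * n / 4 % 4 = 3) ∧ Squarefree (σ * n / 4))) ∧
      σ * n ≡ a [ZMOD m]} : ℝ)
      = (#{n ∈ Ioc (0 : ℤ) N | (σ * n % 4 = 1 ∧ Squarefree (σ * n) ∧ σ * n ≠ 1) ∧
          σ * n ≡ a [ZMOD m]} : ℝ)
        + #{n ∈ Ioc (0 : ℤ) N | (4 ∣ σ * n ∧ (σ * n / 4 % 4 = 2 ∨ σ * n / 4 % 4 = 3) ∧
          Squarefree (σ * n / 4)) ∧ σ * n ≡ a [ZMOD m]} := by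
    rw [Finset.filter_congr (fun n _ => or_and_right), Finset.filter_or,
      Finset.card_union_of_disjoint (Finset.disjoint_filter.mpr fun n _ hA hB => by
        obtain ⟨⟨hA1, -, -⟩, -⟩ := hA
        obtain ⟨⟨hB1, -, -⟩, -⟩ := hB
        generalize σ * n = u at hA1 hB1
        omega), Nat.cast_add]
  -- the density splits the same way: `e(a, 2) = [a ≡ 1 (4)] + [a ≡ 8, 12 (16)]`
  have hdensQ : ttQuadraticFieldsDensity m a =
      (if a % 4 = 1 then dens else 0) +
        (if 4 ∣ a ∧ (a / 4 % 4 = 2 ∨ a / 4 % 4 = 3) then dens else 0) := by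
    have hQ : ttQuadraticFieldsDensity m a = ttLocalFactorTwo a * dens := by
      simp only [ttQuadraticFieldsDensity, hdens]
      ring
    rw [hQ]
    unfold ttLocalFactorTwo
    by_cases ha : a % 4 = 1
    · have hc : ¬ (4 ∣ a ∧ (a / 4 % 4 = 2 ∨ a / 4 % 4 = 3)) := by omega
      rw [if_pos (Or.inl ha), if_pos ha, if_neg hc]
      ring
    · by_cases hc : 4 ∣ a ∧ (a / 4 % 4 = 2 ∨ a / 4 % 4 = 3)
      · have h3 : a % 4 = 1 ∨ a % 16 = 8 ∨ a % 16 = 12 := by omega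
        rw [if_pos h3, if_neg ha, if_pos hc]
        ring
      · have h3 : ¬ (a % 4 = 1 ∨ a % 16 = 8 ∨ a % 16 = 12) := by omega
        rw [if_neg h3, if_neg ha, if_neg hc]
        ring
  rw [hsplit, hdensQ]
  have key : ∀ c1 c2 d1 d2 X B1 B2 : ℝ, |c1 - d1 * X| ≤ B1 → |c2 - d2 * X| ≤ B2 →
      |c1 + c2 - (d1 + d2) * X| ≤ B1 + B2 := by
    intro c1 c2 d1 d2 X B1 B2 h1 h2
    calc |c1 + c2 - (d1 + d2) * X| = |(c1 - d1 * X) + (c2 - d2 * X)| := by congr 1; ring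
      _ ≤ |c1 - d1 * X| + |c2 - d2 * X| := abs_add_le _ _
      _ ≤ B1 + B2 := add_le_add h1 h2
  refine (key _ _ _ _ _ _ _ h1 h2).trans (le_of_eq ?_)
  ring

/-- **Taniguchi–Thorne 2013 (Duke), Lemma 21, proved**: for `2⁶ ∣ m` and each sign, the number of
fundamental discriminants `0 < ±D < X` with `D ≡ a (mod m)` is `ttQuadraticFieldsDensity m a · X + O(√X)`
(implied constant `7 + 5 c'(m, a)`; for `m = 0` the class is a single point).
[cite: TaniguchiThorne2013, Lemma 21] -/
theorem tt_count_quadraticFields_progression_holds : tt_count_quadraticFields_progression := by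
  intro m a hm
  rcases Nat.eq_zero_or_pos m with rfl | hm0
  · refine ⟨1, fun X hX => ?_⟩
    have hd : ttQuadraticFieldsDensity 0 a = 0 := by simp [ttQuadraticFieldsDensity]
    have hsq : (1 : ℝ) ≤ Real.sqrt X := Real.one_le_sqrt.mpr (by exact_mod_cast hX)
    have hle : ∀ s : Finset ℤ, (#(s.filter (fun D => D ≡ a [ZMOD ((0 : ℕ) : ℤ)])) : ℝ) ≤ 1 := by
      intro s
      have h : #(s.filter (fun D => D ≡ a [ZMOD ((0 : ℕ) : ℤ)])) ≤ 1 := by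
        refine Finset.card_le_one.mpr fun x hx y hy => ?_
        simp only [mem_filter, Int.ModEq, Nat.cast_zero, Int.emod_zero] at hx hy
        rw [hx.2, hy.2]
      exact_mod_cast h
    rw [hd]
    simp only [zero_mul, sub_zero, Nat.abs_cast, one_mul]
    exact ⟨(hle _).trans hsq, (hle _).trans hsq⟩
  · refine ⟨7 + 5 * |8 / (Real.pi ^ 2 * m) * ∏ p ∈ m.primeFactors.erase 2,
      ttLocalFactorOdd p (m.factorization p) a * (1 - 1 / (p : ℝ) ^ 2)⁻¹|, fun X hX => ?_⟩
    obtain ⟨N, rfl⟩ : ∃ N, X = N + 1 := ⟨X - 1, by omega⟩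
    have hIoo : Finset.Ioo (0 : ℤ) ((N + 1 : ℕ) : ℤ) = Finset.Ioc (0 : ℤ) N := by
      ext n
      simp only [mem_Ioo, mem_Ioc]
      push_cast
      omega
    have hXr : ((N + 1 : ℕ) : ℝ) = (N : ℝ) + 1 := by push_cast; ring
    constructor
    · have hrefl : #((negFundDiscrs (N + 1)).filter (fun D => D ≡ a [ZMOD m]))
          = #{n ∈ Ioc (0 : ℤ) N | (((-1) * n % 4 = 1 ∧ Squarefree ((-1) * n) ∧ (-1) * n ≠ 1) ∨
              (4 ∣ (-1) * n ∧ ((-1) * n / 4 % 4 = 2 ∨ (-1) * n / 4 % 4 = 3) ∧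
                Squarefree ((-1) * n / 4))) ∧ (-1) * n ≡ a [ZMOD m]} := by
        rw [negFundDiscrs, Finset.filter_filter, card_filter_Ioo_neg, hIoo]
        congr 1
        refine Finset.filter_congr fun n _ => ?_
        simp only [neg_one_mul]
      rw [hrefl, hXr]
      exact abs_card_fundDiscr_sign_sub_le hm0.ne' hm a (Or.inr rfl) N
    · have hpos : #((posFundDiscrs (N + 1)).filter (fun D => D ≡ a [ZMOD m]))
          = #{n ∈ Ioc (0 : ℤ) N | (((1 : ℤ) * n % 4 = 1 ∧ Squarefree ((1 : ℤ) * n) ∧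
              (1 : ℤ) * n ≠ 1) ∨ (4 ∣ (1 : ℤ) * n ∧ ((1 : ℤ) * n / 4 % 4 = 2 ∨
                (1 : ℤ) * n / 4 % 4 = 3) ∧ Squarefree ((1 : ℤ) * n / 4))) ∧
              (1 : ℤ) * n ≡ a [ZMOD m]} := by
        rw [posFundDiscrs, Finset.filter_filter, hIoo]
        congr 1
        refine Finset.filter_congr fun n _ => ?_
        simp only [one_mul]
      rw [hpos, hXr]
      exact abs_card_fundDiscr_sign_sub_le hm0.ne' hm a (Or.inl rfl) N

end Literature.NumberTheory.QuadraticFields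

end
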